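import Mathlib
import Summits.PneNP.PneNP.Theorems.OverlapGapAlgebraSolvableImpliesStableSectionMeanSquareFromMeanFilter
import Summits.PneNP.PneNP.Theorems.OverlapGapAlgebraSolvableImpliesStableSectionMonotoneRepairMean
import Summits.PneNP.PneNP.Theorems.OverlapGapAlgebraSolvableImpliesStableSectionMonotoneRepairLocal
import Summits.PneNP.PneNP.Theorems.OverlapGapAlgebraSolvableImpliesStableSectionMonotoneRepairObjects
import Summits.PneNP.PneNP.Theorems.OverlapGapAlgebraSolvableImpliesStableSectionPurePeelingAssembly

/-!
# PneNP / OverlapGapAlgebra — crux `SolvableImpliesStableSection` (stmt-PneNP-2463):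
# the MONOTONE REPAIR block (18/18) — assembly: the crux's conclusion is TRUE up to `α ≤ 2^k/(4k)`

Support for crux `stmt-PneNP-2463` (`Summit.PneNP.PneNP.Theses.OverlapGapAlgebra.SolvableImpliesStableSection`).

* `sissR_conclusion_of_density_le` — **the f-free monotone-repair block.** For every `k ≥ 1`, every
  density `0 < α ≤ 2^k/(4k)`, all `η > 0`, every `ν` above the dead floor `α^k/2^{k²}`
  (`≤ (4k)^{-k}`) and every `c > 0`: for ALL large `n` (`m = ⌊α n⌋₊`) some section `g` is
  `νm`-valid at every splice point of the Bresler–Huang path and moves by at most `ηn` between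
  consecutive splice points on at least `e^{-cn}·#paths` of the path tuples — the CONCLUSION of the
  crux at `(k, α, η, ν)`, with no solver in sight.  The section is `Λ` rounds of MONOTONE REPAIR
  (every violated clause sets its least negative variable to `false`): a radius-`Λ` local rule
  (`sissR_local`), hence ℓ²-stable, violating in the mean at most
  `m·(2^{-k-Λ} + α^k 2^{-k²}) + O_{k,Λ}(m/n)` clauses (`sissR_sum_card_violated_le`: witness trees
  with sign constraints, exact counts of injective trees, geometric decay of the weights at ratio
  `< 1/2` under `4k·α ≤ 2^k`, bad walks for the non-injective ones); the engine from a mean bound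
  (`sissMV_concl_of_localMean`) does the rest.
* `sissR_solvableImpliesStableSection_of_density_le` — the crux VERBATIM at such `(k, α, η, ν)`
  (its hypothesis unused).
* `sissR_solvableImpliesStableSection_off_core` — planner summary superseding
  `sissQ_solvableImpliesStableSection_off_core`: the crux holds whenever
  `α < 2/k ∨ (4kα ≤ 2^k ∧ α^k < 2^{k²} ν) ∨ α ≥ 2^k log 2 ∨ η ≥ 1 ∨ ν > 2^{-k} ∨ ν > 2^{-k}(e^{kα2^{-k}} - 1)`:
  the low-density edge of the residual core moves from `2/k` to `2^k/(4k)` (a factor `2^{k-3}`), up to a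
  sliver `ν ≤ α^k/2^{k²} ≤ (4k)^{-k}` of doubly-exponentially small violation levels.
No new definitions; axioms `propext`, `Classical.choice`, `Quot.sound`.
-/

set_option linter.dupNamespace false -- `Summit.PneNP.PneNP.…`: summit = sub-problem (D-0017)

namespace Summit.PneNP.PneNP.Theorems

open Finset Filter Asymptotics
open scoped Classical

section Assembly

/-- **The monotone-repair block: the conclusion of `SolvableImpliesStableSection` holds for
`α ≤ 2^k/(4k)` above the dead floor.** For every `k ≥ 1`, `α > 0` with `4k·α ≤ 2^k`, all `η > 0`,
every `ν` with `α^k < 2^{k²}·ν` and every `c > 0`: for all large `n` (`m = ⌊α n⌋₊`) some map `g`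
(bounded-round monotone repair) is `νm`-valid at every splice point of the Bresler–Huang path and
`ηn`-stable between consecutive splice points on at least `e^{-cn}·#paths` of the path tuples
`Ψ : Fin (k+1) → instances`. -/
theorem sissR_conclusion_of_density_le (k : ℕ) (hk : 1 ≤ k) (α η ν : ℝ) (hα : 0 < α)
    (hαk : α * (4 * k) ≤ (2 : ℝ) ^ k) (hη : 0 < η) (hν : α ^ k < ν * 2 ^ (k * k))
    (c : ℝ) (hc : 0 < c) :
    ∀ᶠ n : ℕ in atTop, ∀ m : ℕ, m = ⌊α * n⌋₊ →
      ∃ g : (Fin m → Fin k → Fin n × Bool) → (Fin n → Bool),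
        Real.exp (-(c * n)) * Fintype.card (Fin (k + 1) → Fin m → Fin k → Fin n × Bool) ≤
        ((Finset.univ.filter fun Ψ : Fin (k + 1) → Fin m → Fin k → Fin n × Bool =>
          let P : Fin k → ℕ → Fin m → Fin k → Fin n × Bool :=
            fun r q a b => if (a : ℕ) * k + b < q then Ψ r.succ a b else Ψ r.castSucc a b
          (∀ r : Fin k, ∀ q ≤ m * k, ((Finset.univ.filter fun i : Fin m =>
            ∀ j, g (P r q) (P r q i j).1 ≠ (P r q i j).2).card : ℝ) ≤ ν * m) ∧
          ∀ r : Fin k, ∀ q < m * k,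
            (hammingDist (g (P r q)) (g (P r (q + 1))) : ℝ) ≤ η * n).card : ℝ) := by
  have hk0R : (0 : ℝ) < k := by exact_mod_cast hk
  -- the dead floor `F = α^k 2^{-k²}` and the target mean level `μ`
  set F : ℝ := α ^ k * (1 / 2 : ℝ) ^ (k * k) with hF
  have hFν : F < ν := by
    rw [hF, one_div_pow, ← div_eq_mul_one_div, div_lt_iff₀ (by positivity)]
    exact hν
  set μ : ℝ := (ν + F) / 2 with hμ
  have hμν : μ < ν := by rw [hμ]; linarith
  have hFμ : F < μ := by rw [hμ]; linarith
  have hgap : 0 < μ - F := sub_pos.2 hFμ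
  -- the number of rounds `Λ = L + 1`
  obtain ⟨L, hL⟩ : ∃ L : ℕ, (1 / 2 : ℝ) ^ L < (μ - F) / 2 :=
    exists_pow_lt_of_lt_one (by positivity) (by norm_num)
  have hΛ1 : 1 ≤ L + 1 := Nat.le_add_left 1 L
  have hpowΛ : (1 / 2 : ℝ) ^ (L + 1) ≤ (μ - F) / 2 :=
    (pow_le_pow_of_le_one (by norm_num) (by norm_num) (Nat.le_succ L)).trans hL.le
  -- the bad-walk constant
  set B : ℝ := ∑ Lw ∈ Finset.range (2 * (L + 1) + 1),
    α ^ Lw * ((k : ℝ) ^ (Lw + 1) * (k : ℝ) ^ (Lw + 1) * (((Lw : ℝ) + 1) * k)) with hB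
  have hB0 : 0 ≤ B := Finset.sum_nonneg fun Lw _ => by positivity
  refine sissMV_concl_of_localMean k (L + 1) hk α η ν μ hα hη hμν ?_ c hc
  have hlarge : ∀ᶠ n : ℕ in atTop, 2 * B / (μ - F) ≤ (n : ℝ) :=
    tendsto_natCast_atTop_atTop.eventually_ge_atTop _
  filter_upwards [eventually_ge_atTop 1, hlarge] with n hn1 hnB m hm
  have hnR : (1 : ℝ) ≤ n := by exact_mod_cast hn1
  have hnpos : (0 : ℝ) < n := by linarith
  have hm0 : (0 : ℝ) ≤ m := Nat.cast_nonneg _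
  have hm_le : (m : ℝ) ≤ α * n := by rw [hm]; exact Nat.floor_le (by positivity)
  have hmn : (m : ℝ) / n ≤ α := by rw [div_le_iff₀ hnpos]; exact hm_le
  have hα' : (m : ℝ) * (4 * k) ≤ (n : ℝ) * 2 ^ k :=
    calc (m : ℝ) * (4 * k) ≤ α * n * (4 * k) := mul_le_mul_of_nonneg_right hm_le (by positivity)
      _ = n * (α * (4 * k)) := by ring
      _ ≤ n * 2 ^ k := mul_le_mul_of_nonneg_left hαk hnpos.le
  have hBn : B / n ≤ (μ - F) / 2 := by
    rw [div_le_iff₀ hnpos]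
    rw [div_le_iff₀ hgap] at hnB
    linarith
  -- the objects of the block
  obtain ⟨val, hval0, hvalS⟩ := sissR_exists_val (m := m) (k := k) (n := n)
  obtain ⟨asm, hasm⟩ := sissR_exists_asm (m := m) (k := k)
  obtain ⟨TS, hTS0, hTSs⟩ := sissR_exists_TS asm (L + 1)
  refine ⟨fun Φ v => val (L + 1) Φ v, fun Φ Φ' v H => sissR_local val hval0 hvalS (L + 1) Φ Φ' v H, ?_⟩
  -- the mean violation
  have hmean := sissR_sum_card_violated_le asm hasm TS (L + 1) hTS0 hTSs val hval0 hvalS hk hn1 hα' hΛ1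
  refine hmean.trans ?_
  set N : ℝ := (Fintype.card (Fin m → Fin k → Fin n × Bool) : ℝ) with hN
  have hN0 : 0 ≤ N := Nat.cast_nonneg _
  -- term 1: the geometric tail
  have hT1 : (m : ℝ) * (1 / 2 : ℝ) ^ k * (1 / 2 : ℝ) ^ (L + 1) ≤ (m : ℝ) * ((μ - F) / 2) := by
    have h1 : (1 / 2 : ℝ) ^ k ≤ 1 := pow_le_one₀ (by norm_num) (by norm_num)
    calc (m : ℝ) * (1 / 2 : ℝ) ^ k * (1 / 2 : ℝ) ^ (L + 1) ≤ (m : ℝ) * 1 * ((μ - F) / 2) := by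
          apply mul_le_mul (mul_le_mul_of_nonneg_left h1 hm0) hpowΛ (by positivity) (by positivity)
      _ = (m : ℝ) * ((μ - F) / 2) := by ring
  -- term 2: the dead floor
  have hT2 : (m : ℝ) * (1 / 2 : ℝ) ^ k * (2 * ((m : ℝ) * (1 / 2 : ℝ) ^ k / n)) ^ k ≤ (m : ℝ) * F := by
    have hle : 2 * ((m : ℝ) * (1 / 2 : ℝ) ^ k / n) ≤ 2 * (α * (1 / 2 : ℝ) ^ k) := by
      rw [mul_div_right_comm]
      exact mul_le_mul_of_nonneg_left (mul_le_mul_of_nonneg_right hmn (by positivity)) (by norm_num)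
    have h22 : (1 / 2 : ℝ) ^ k * (2 : ℝ) ^ k = 1 := by rw [← mul_pow]; norm_num
    have hid : (1 / 2 : ℝ) ^ k * (2 * (α * (1 / 2 : ℝ) ^ k)) ^ k = F := by
      rw [hF, mul_pow, mul_pow]
      calc (1 / 2 : ℝ) ^ k * ((2 : ℝ) ^ k * (α ^ k * ((1 / 2 : ℝ) ^ k) ^ k))
          = ((1 / 2 : ℝ) ^ k * (2 : ℝ) ^ k) * (α ^ k * ((1 / 2 : ℝ) ^ k) ^ k) := by ring
        _ = α ^ k * (1 / 2 : ℝ) ^ (k * k) := by rw [h22, one_mul, ← pow_mul]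
    calc (m : ℝ) * (1 / 2 : ℝ) ^ k * (2 * ((m : ℝ) * (1 / 2 : ℝ) ^ k / n)) ^ k
        ≤ (m : ℝ) * ((1 / 2 : ℝ) ^ k * (2 * (α * (1 / 2 : ℝ) ^ k)) ^ k) := by
          rw [mul_assoc]
          exact mul_le_mul_of_nonneg_left (mul_le_mul_of_nonneg_left
            (pow_le_pow_left₀ (by positivity) hle k) (by positivity)) hm0
      _ = (m : ℝ) * F := by rw [hid]
  -- term 3: the bad walks
  have hT3 : ∑ Lw ∈ Finset.range (2 * (L + 1) + 1),
      ((m : ℝ) ^ (Lw + 1) * (k : ℝ) ^ (Lw + 1) * (k : ℝ) ^ (Lw + 1) * (((Lw : ℝ) + 1) * k) * N) /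
        (n : ℝ) ^ (Lw + 1) ≤ (m : ℝ) * N * (B / n) := by
    have hterm : ∀ Lw : ℕ, ((m : ℝ) ^ (Lw + 1) * (k : ℝ) ^ (Lw + 1) * (k : ℝ) ^ (Lw + 1) *
        (((Lw : ℝ) + 1) * k) * N) / (n : ℝ) ^ (Lw + 1)
          ≤ (m : ℝ) * N * (α ^ Lw * ((k : ℝ) ^ (Lw + 1) * (k : ℝ) ^ (Lw + 1) * (((Lw : ℝ) + 1) * k)) / n) := by
      intro Lw
      have hpow : (m : ℝ) ^ (Lw + 1) / (n : ℝ) ^ (Lw + 1) ≤ α ^ Lw * ((m : ℝ) / n) := by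
        rw [← div_pow, pow_succ]
        exact mul_le_mul_of_nonneg_right (pow_le_pow_left₀ (by positivity) hmn Lw) (by positivity)
      have hK : 0 ≤ (k : ℝ) ^ (Lw + 1) * (k : ℝ) ^ (Lw + 1) * (((Lw : ℝ) + 1) * k) * N := by positivity
      calc ((m : ℝ) ^ (Lw + 1) * (k : ℝ) ^ (Lw + 1) * (k : ℝ) ^ (Lw + 1) * (((Lw : ℝ) + 1) * k) * N) /
            (n : ℝ) ^ (Lw + 1)
          = ((m : ℝ) ^ (Lw + 1) / (n : ℝ) ^ (Lw + 1)) *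
              ((k : ℝ) ^ (Lw + 1) * (k : ℝ) ^ (Lw + 1) * (((Lw : ℝ) + 1) * k) * N) := by ring
        _ ≤ (α ^ Lw * ((m : ℝ) / n)) *
              ((k : ℝ) ^ (Lw + 1) * (k : ℝ) ^ (Lw + 1) * (((Lw : ℝ) + 1) * k) * N) :=
            mul_le_mul_of_nonneg_right hpow hK
        _ = (m : ℝ) * N * (α ^ Lw * ((k : ℝ) ^ (Lw + 1) * (k : ℝ) ^ (Lw + 1) * (((Lw : ℝ) + 1) * k)) / n) := by
            ring
    refine (Finset.sum_le_sum fun Lw _ => hterm Lw).trans (le_of_eq ?_)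
    rw [← Finset.mul_sum, ← Finset.sum_div]
  -- total
  calc N * ((m : ℝ) * (1 / 2 : ℝ) ^ k * ((1 / 2 : ℝ) ^ (L + 1) + (2 * ((m : ℝ) * (1 / 2 : ℝ) ^ k / n)) ^ k)) +
        ∑ Lw ∈ Finset.range (2 * (L + 1) + 1),
          ((m : ℝ) ^ (Lw + 1) * (k : ℝ) ^ (Lw + 1) * (k : ℝ) ^ (Lw + 1) * (((Lw : ℝ) + 1) * k) * N) /
            (n : ℝ) ^ (Lw + 1)
      ≤ N * ((m : ℝ) * ((μ - F) / 2) + (m : ℝ) * F) + (m : ℝ) * N * (B / n) := by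
        refine add_le_add ?_ hT3
        rw [mul_add]
        exact mul_le_mul_of_nonneg_left (add_le_add hT1 hT2) hN0
    _ ≤ N * ((m : ℝ) * ((μ - F) / 2) + (m : ℝ) * F) + (m : ℝ) * N * ((μ - F) / 2) := by
        have : 0 ≤ (m : ℝ) * N := by positivity
        nlinarith
    _ = μ * m * N := by ring

/-- **`SolvableImpliesStableSection` up to density `2^k/(4k)`, above the dead floor.** For every
`k ≥ 3`, `α > 0` with `4k·α ≤ 2^k`, all `η > 0` and `ν > 0` with `α^k < 2^{k²}·ν`, the implication of
the crux at `(k, α, η, ν)` holds — its conclusion is true outright (`sissR_conclusion_of_density_le`),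
the solver hypothesis is not used. -/
theorem sissR_solvableImpliesStableSection_of_density_le (k : ℕ) (hk : 3 ≤ k) (α η ν : ℝ)
    (hα : 0 < α) (hαk : α * (4 * k) ≤ (2 : ℝ) ^ k) (hη : 0 < η) (_hν : 0 < ν)
    (hνfloor : α ^ k < ν * 2 ^ (k * k))
    (_hsolv : ∃ f : List Bool → List Bool, Literature.Computability.Complexity.IsPolyTime f ∧
      ∃ ε : ℝ, 0 < ε ∧ ∃ᶠ n : ℕ in Filter.atTop, ∀ m : ℕ, m = ⌊α * n⌋₊ → ε ≤
        ((Finset.univ.filter fun Φ : Fin m → Fin k → Fin n × Bool => ∀ i, ∃ j,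
          (f (Literature.Computability.Complexity.encodingCNF.encode (List.ofFn fun a =>
            List.ofFn fun b => (((Φ a b).1 : ℕ), (Φ a b).2)))).getD (Φ i j).1 false =
              (Φ i j).2).card : ℝ) / Fintype.card (Fin m → Fin k → Fin n × Bool))
    (c : ℝ) (hc : 0 < c) :
    ∃ᶠ n : ℕ in Filter.atTop, ∀ m : ℕ, m = ⌊α * n⌋₊ →
      ∃ g : (Fin m → Fin k → Fin n × Bool) → (Fin n → Bool),
        Real.exp (-(c * n)) * Fintype.card (Fin (k + 1) → Fin m → Fin k → Fin n × Bool) ≤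
        ((Finset.univ.filter fun Ψ : Fin (k + 1) → Fin m → Fin k → Fin n × Bool =>
          let P : Fin k → ℕ → Fin m → Fin k → Fin n × Bool :=
            fun r q a b => if (a : ℕ) * k + b < q then Ψ r.succ a b else Ψ r.castSucc a b
          (∀ r : Fin k, ∀ q ≤ m * k, ((Finset.univ.filter fun i : Fin m =>
            ∀ j, g (P r q) (P r q i j).1 ≠ (P r q i j).2).card : ℝ) ≤ ν * m) ∧
          ∀ r : Fin k, ∀ q < m * k,
            (hammingDist (g (P r q)) (g (P r (q + 1))) : ℝ) ≤ η * n).card : ℝ) :=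
  (sissR_conclusion_of_density_le k (le_trans (by norm_num) hk) α η ν hα hαk hη hνfloor c hc).frequently

/-- **The crux off the (smaller) core region.** For every `k ≥ 3` and `α, η, ν > 0` with `α < 2/k`,
or `4k·α ≤ 2^k` and `α^k < 2^{k²}·ν`, or `α ≥ 2^k log 2`, or `η ≥ 1`, or `ν > 2^{-k}`, or
`ν > 2^{-k}(e^{kα2^{-k}} - 1)`, the implication of `SolvableImpliesStableSection` at `(k, α, η, ν)`
holds. Supersedes `sissQ_solvableImpliesStableSection_off_core` (low-density edge `2/k ↦ 2^k/(4k)` up to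
the sliver `ν ≤ α^k/2^{k²} ≤ (4k)^{-k}`): what remains of the crux is the core region
`{2^k/(4k) < α < 2^k log 2} ∩ {η < 1} ∩ {ν ≤ 2^{-k} min(1, e^{kα2^{-k}} - 1)}` together with the sliver
`{2/k ≤ α ≤ 2^k/(4k)} ∩ {ν ≤ α^k/2^{k²}}` — summit-strength inside the Bresler–Huang window
(`transfer_false_without_polyTime`), f-free open elsewhere. -/
theorem sissR_solvableImpliesStableSection_off_core (k : ℕ) (hk : 3 ≤ k) (α η ν : ℝ) (hα : 0 < α)
    (hη : 0 < η) (hν : 0 < ν)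
    (hoff : α < 2 / (k : ℝ) ∨ (α * (4 * k) ≤ (2 : ℝ) ^ k ∧ α ^ k < ν * 2 ^ (k * k)) ∨
      (2 : ℝ) ^ k * Real.log 2 ≤ α ∨ 1 ≤ η ∨ (1 / 2 : ℝ) ^ k < ν ∨
      (1 / 2 : ℝ) ^ k * (Real.exp (k * α * (1 / 2 : ℝ) ^ k) - 1) < ν)
    (hsolv : ∃ f : List Bool → List Bool, Literature.Computability.Complexity.IsPolyTime f ∧
      ∃ ε : ℝ, 0 < ε ∧ ∃ᶠ n : ℕ in Filter.atTop, ∀ m : ℕ, m = ⌊α * n⌋₊ → ε ≤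
        ((Finset.univ.filter fun Φ : Fin m → Fin k → Fin n × Bool => ∀ i, ∃ j,
          (f (Literature.Computability.Complexity.encodingCNF.encode (List.ofFn fun a =>
            List.ofFn fun b => (((Φ a b).1 : ℕ), (Φ a b).2)))).getD (Φ i j).1 false =
              (Φ i j).2).card : ℝ) / Fintype.card (Fin m → Fin k → Fin n × Bool))
    (c : ℝ) (hc : 0 < c) :
    ∃ᶠ n : ℕ in Filter.atTop, ∀ m : ℕ, m = ⌊α * n⌋₊ →
      ∃ g : (Fin m → Fin k → Fin n × Bool) → (Fin n → Bool),
        Real.exp (-(c * n)) * Fintype.card (Fin (k + 1) → Fin m → Fin k → Fin n × Bool) ≤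
        ((Finset.univ.filter fun Ψ : Fin (k + 1) → Fin m → Fin k → Fin n × Bool =>
          let P : Fin k → ℕ → Fin m → Fin k → Fin n × Bool :=
            fun r q a b => if (a : ℕ) * k + b < q then Ψ r.succ a b else Ψ r.castSucc a b
          (∀ r : Fin k, ∀ q ≤ m * k, ((Finset.univ.filter fun i : Fin m =>
            ∀ j, g (P r q) (P r q i j).1 ≠ (P r q i j).2).card : ℝ) ≤ ν * m) ∧
          ∀ r : Fin k, ∀ q < m * k,
            (hammingDist (g (P r q)) (g (P r (q + 1))) : ℝ) ≤ η * n).card : ℝ) := by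
  rcases hoff with hlow | ⟨hαk, hνfloor⟩ | hrest
  · exact sissQ_solvableImpliesStableSection_off_core k hk α η ν hα hη hν (Or.inl hlow) hsolv c hc
  · exact sissR_solvableImpliesStableSection_of_density_le k hk α η ν hα hαk hη hν hνfloor hsolv c hc
  · exact sissQ_solvableImpliesStableSection_off_core k hk α η ν hα hη hν (Or.inr hrest) hsolv c hc

end Assembly

end Summit.PneNP.PneNP.Theorems
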